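/-
Part A2 of the (nb, neg) census row V44 «DILATIONS > 1 / WIENER COLLAPSE» kernel (cell rh-split, lane (xv-W) of RULING #292):
nb-neg g19 `NbDilationA.lean` sha16 91cb75048c825c65, source ll.255–535 verbatim (§4 Fourier uniqueness + orthogonality,
the MAIN THEOREM `nb_unbounded_dilations` and `nb_dilations_pow`); split only because Theorems files with proofs are
≤ 400 lines; part A1 = `NbDilationA.lean` (ll.1–253).  RH-free.  Nothing here bears on the truth of RH.
-/
import Summits.RiemannHypothesis.RiemannHypothesis.Theorems.Splittings.NbDilationA
import HarnessLib

/-!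
# RH-EQUIVALENT·SPLITTING CENSUS (nb, neg) · V44 «DILATIONS > 1 / WIENER COLLAPSE», part A2:
the Nyman–Beurling closure over an UNBOUNDED dilation menu holds unconditionally (main theorem); nothing here
bears on the truth of RH

See the module docstring of part A1 (`NbDilationA.lean`) for the statement NB(Θ), the proof plan (Wiener's `L²`
Tauberian theorem in logarithmic coordinates, Plancherel, Fourier uniqueness, `ζ(1/2+it) ≠ 0` a.e.) and the labels:
a split `A ∧ B ⟹ RH` with `A =` NB(unbounded menu) is DECORATION (A is a theorem — `nb_unbounded_dilations` below);
part B (`NbDilationB.lean`) shows the bounded power menus are RH-EQUIVALENT (COSTUME).  Barrier of record B24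
«NB-DILATION»; targets T47a–e.  Kernel hygiene as in part A1: no `sorry`, no new axioms, no `private`, no instances,
no notation.
-/

open MeasureTheory Set Filter Complex FourierTransform SchwartzMap
open scoped ENNReal Topology Real ComplexConjugate InnerProductSpace

set_option linter.dupNamespace false

namespace Summit.RiemannHypothesis.RiemannHypothesis.Theorems.Splittings.NbDilation

open Literature.NumberTheory.LFunctions Literature.NumberTheory.LFunctions.BaezDuarteOnlyIf
  Literature.Analysis.FunctionSpaces
  Summit.RiemannHypothesis.RiemannHypothesis.Theorems.Splittings.NbTargets

/-! ## 4. Fourier uniqueness and the orthogonality argument -/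

/-- **Fourier uniqueness on `L¹(ℝ)`**: an integrable `H` whose Fourier integral vanishes
identically is `0` a.e. (pair `H` against `𝓕χ`, `χ` Schwartz, using self-adjointness of the
Fourier integral and surjectivity of `𝓕` on the Schwartz space; then
`ae_eq_zero_of_integral_contDiff_smul_eq_zero`). [folklore] -/
theorem ae_eq_zero_of_forall_fourierIntegral_eq_zero {H : ℝ → ℂ} (hH : Integrable H)
    (h0 : ∀ x : ℝ, 𝓕 H x = 0) : ∀ᵐ ξ : ℝ, H ξ = 0 := by
  refine ae_eq_zero_of_integral_contDiff_smul_eq_zero hH.locallyIntegrable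
    fun g hg_smooth hg_supp ↦ ?_
  have hgc_smooth : ContDiff ℝ (⊤ : ℕ∞) fun x ↦ (g x : ℂ) := ofRealCLM.contDiff.comp hg_smooth
  have hgc_supp : HasCompactSupport fun x ↦ (g x : ℂ) := hg_supp.comp_left ofReal_zero
  set ψ : 𝓢(ℝ, ℂ) := hgc_supp.toSchwartzMap hgc_smooth with hψ_def
  have hψ : ∀ x, ψ x = (g x : ℂ) := fun x ↦ rfl
  have hχψ : 𝓕 (𝓕⁻ ψ) = ψ := fourier_fourierInv_eq ψ
  calc ∫ x, g x • H x = ∫ x, ψ x • H x := by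
        refine integral_congr_ae (Eventually.of_forall fun x ↦ ?_)
        simp only [hψ, Complex.coe_smul]
    _ = ∫ x, 𝓕 ((𝓕⁻ ψ : 𝓢(ℝ, ℂ)) : ℝ → ℂ) x • H x := by rw [← fourier_coe, hχψ]
    _ = ∫ x, (𝓕⁻ ψ : 𝓢(ℝ, ℂ)) x • 𝓕 H x := integral_fourier_schwartz_smul_eq _ hH
    _ = 0 := by simp [h0]

/-- `ζ(1/2 + 2πiξ) ≠ 0` for a.e. `ξ` (the zeros of `ζ` are countable; tree
`countable_riemannZeta_zeros`). [folklore] -/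
theorem ae_zeta_line_ne_zero :
    ∀ᵐ ξ : ℝ, riemannZeta (((1 / 2 : ℝ) : ℂ) + ((2 * π * ξ : ℝ) : ℂ) * I) ≠ 0 := by
  set F : ℝ → ℂ := fun ξ ↦ ((1 / 2 : ℝ) : ℂ) + ((2 * π * ξ : ℝ) : ℂ) * I with hF
  have hinj : Function.Injective F := by
    intro a b hab
    have h := congrArg Complex.im hab
    simp only [hF, add_im, ofReal_im, mul_im, ofReal_re, I_im, mul_one, I_re, mul_zero,
      add_zero, zero_add] at h
    have hπ : (2 * π : ℝ) ≠ 0 := by positivity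
    exact mul_left_cancel₀ hπ h
  have hsub : {ξ : ℝ | riemannZeta (F ξ) = 0} ⊆ F ⁻¹' {z : ℂ | z ≠ 1 ∧ riemannZeta z = 0} := by
    intro ξ hξ
    refine ⟨fun h ↦ ?_, hξ⟩
    have h2 := congrArg Complex.re h
    simp only [hF, add_re, ofReal_re, mul_re, I_re, mul_zero, ofReal_im, I_im, one_re] at h2
    norm_num at h2
  have hc : {ξ : ℝ | riemannZeta (F ξ) = 0}.Countable :=
    (countable_riemannZeta_zeros.preimage_of_injOn hinj.injOn).mono hsub
  rw [ae_iff]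
  simp only [ne_eq, not_not]
  exact hc.measure_zero volume

/-- **The orthogonality argument (Wiener's `L²` theorem made explicit).**  Let `θ : ℕ → ℝ` be
positive and unbounded.  If `φ ∈ L²(ℝ)` is orthogonal to every log-pulled generator
`u ↦ e^{-u/2}{t e^{u}}`, `t = θ_j/(k+1)`, then `φ = 0`.  [folklore: Wiener's Tauberian theorem
in `L²` — the translates of `ψ` span `L²(ℝ)` iff `𝓕ψ ≠ 0` a.e.] -/
theorem eq_zero_of_forall_inner_gen_eq_zero (θ : ℕ → ℝ) (hθ : ∀ j, 0 < θ j)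
    (hunb : ∀ T : ℝ, ∃ j, T < θ j) (φ : Lp ℂ 2 (volume : Measure ℝ))
    (horth : ∀ (j k : ℕ) (hm : MemLp (fun u : ℝ ↦ Real.exp (-(1 / 2 : ℝ) * u) •
        (((Int.fract (θ j / ((k : ℝ) + 1) / Real.exp (-u)) : ℝ) : ℂ))) 2 volume),
      ⟪hm.toLp _, φ⟫_ℂ = 0) :
    φ = 0 := by
  set s : ℝ → ℂ := fun ξ ↦ ((1 / 2 : ℝ) : ℂ) + ((2 * π * ξ : ℝ) : ℂ) * I with hs_def
  set w : ℝ → ℂ := fun ξ ↦ mellin (fun x : ℝ ↦ ((Int.fract (1 / x) : ℝ) : ℂ)) (s ξ) with hw_def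
  -- `w = 𝓕ψ`, `ψ` the log-pulled generator with `t = 1`; hence `w ∈ L²`
  have hw_eq : 𝓕 (fun u : ℝ ↦ Real.exp (-(1 / 2 : ℝ) * u) •
      (((Int.fract (1 / Real.exp (-u)) : ℝ) : ℂ))) = w := by
    funext ξ
    rw [fourier_gen_eq one_pos ξ]
    simp [hw_def, hs_def]
  have hw2 : MemLp w 2 (volume : Measure ℝ) := by
    rw [← hw_eq]; exact memLp_two_fourierIntegral (integrable_gen one_pos) (memLp_gen one_pos)
  set Φ : Lp ℂ 2 (volume : Measure ℝ) := 𝓕 φ with hΦ_def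
  set W : Lp ℂ 2 (volume : Measure ℝ) := hw2.toLp w with hW_def
  -- the integrable function `H = conj(w) · Φ`
  set H : ℝ → ℂ := fun ξ ↦ conj (w ξ) * (Φ : ℝ → ℂ) ξ with hH_def
  have hH_ae : (fun ξ ↦ ⟪(W : ℝ → ℂ) ξ, (Φ : ℝ → ℂ) ξ⟫_ℂ) =ᵐ[volume] H := by
    filter_upwards [hw2.coeFn_toLp] with ξ hξ
    rw [hH_def, RCLike.inner_apply', hξ]
  have hH : Integrable H := (L2.integrable_inner (𝕜 := ℂ) W Φ).congr hH_ae
  -- inner products with the generators are values of `𝓕 H` on `log Θ`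
  have hinner : ∀ {t : ℝ} (ht : 0 < t) (hm : MemLp (fun u : ℝ ↦ Real.exp (-(1 / 2 : ℝ) * u) •
      (((Int.fract (t / Real.exp (-u)) : ℝ) : ℂ))) 2 volume),
      ⟪hm.toLp _, φ⟫_ℂ = ((Real.sqrt t : ℝ) : ℂ) * 𝓕 H (Real.log t) := by
    intro t ht hm
    rw [← Lp.inner_fourier_eq, L2.inner_def]
    have hv := fourier_toLp_ae_eq_fourierIntegral (integrable_gen ht) hm
    have step1 : ∫ ξ, ⟪((𝓕 (hm.toLp _) : Lp ℂ 2 (volume : Measure ℝ)) : ℝ → ℂ) ξ,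
        (Φ : ℝ → ℂ) ξ⟫_ℂ = ∫ ξ, conj (((t⁻¹ : ℝ) : ℂ) ^ (-(s ξ)) * w ξ) * (Φ : ℝ → ℂ) ξ := by
      refine integral_congr_ae ?_
      filter_upwards [hv] with ξ hξ
      rw [RCLike.inner_apply', hξ, fourier_gen_eq ht ξ]
    rw [step1, Real.fourier_real_eq_integral_exp_smul, ← integral_const_mul]
    refine integral_congr_ae (Eventually.of_forall fun ξ ↦ ?_)
    simp only [hH_def, smul_eq_mul, map_mul]
    rw [show -(s ξ) = -(((1 / 2 : ℝ) : ℂ) + ((2 * π * ξ : ℝ) : ℂ) * I) by rfl,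
      conj_inv_cpow_neg_line ht ξ]
    push_cast
    ring
  have hzero : ∀ j k : ℕ, 𝓕 H (Real.log (θ j / ((k : ℝ) + 1))) = 0 := by
    intro j k
    have ht : 0 < θ j / ((k : ℝ) + 1) := div_pos (hθ j) (Nat.cast_add_one_pos k)
    have h := horth j k (memLp_gen ht)
    rw [hinner ht] at h
    have hsq : ((Real.sqrt (θ j / ((k : ℝ) + 1)) : ℝ) : ℂ) ≠ 0 := by
      exact_mod_cast (Real.sqrt_pos.2 ht).ne'
    exact (mul_eq_zero.1 h).resolve_left hsq
  -- `𝓕 H` is continuous and vanishes on a dense set, hence everywhere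
  have hcont : Continuous (𝓕 H) := continuous_fourierIntegral hH
  have hFH : ∀ x : ℝ, 𝓕 H x = 0 := by
    intro x
    by_contra hx
    have hpos : 0 < ‖𝓕 H x‖ := norm_pos_iff.2 hx
    obtain ⟨δ, hδ, hδ'⟩ := Metric.continuous_iff.1 hcont x ‖𝓕 H x‖ hpos
    obtain ⟨j, k, hjk⟩ := exists_abs_log_div_sub_lt θ hθ hunb x hδ
    have h := hδ' (Real.log (θ j / ((k : ℝ) + 1))) (by rwa [Real.dist_eq])
    rw [hzero j k, dist_comm, dist_zero_right] at h
    exact lt_irrefl _ h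
  -- hence `H = 0` a.e., and since `w ≠ 0` a.e., `Φ = 0` a.e.
  have hH0 : ∀ᵐ ξ : ℝ, H ξ = 0 := ae_eq_zero_of_forall_fourierIntegral_eq_zero hH hFH
  have hw0 : ∀ᵐ ξ : ℝ, w ξ ≠ 0 := by
    filter_upwards [ae_zeta_line_ne_zero] with ξ hξ
    have hs0 : 0 < (s ξ).re := by simp [hs_def]
    have hs1 : (s ξ).re < 1 := by simp [hs_def]; norm_num
    have hsne : s ξ ≠ 0 := fun h ↦ by rw [h] at hs0; simp at hs0
    have hξ' : riemannZeta (s ξ) ≠ 0 := hξ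
    rw [hw_def]
    simp only
    rw [(hasMellin_fract_div one_pos hs0 hs1).2]
    simp [hξ', hsne]
  have hΦ0 : (Φ : ℝ → ℂ) =ᵐ[volume] 0 := by
    filter_upwards [hH0, hw0] with ξ h1 h2
    have h3 : conj (w ξ) ≠ 0 := by simpa using h2
    exact (mul_eq_zero.1 h1).resolve_left h3
  have hΦ : Φ = 0 := Lp.eq_zero_iff_ae_eq_zero.2 hΦ0
  have hn : ‖φ‖ = 0 := by rw [← Lp.norm_fourier_eq, ← hΦ_def, hΦ, norm_zero]
  exact norm_eq_zero.1 hn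

/-! ## 5. Density and the pull-back to `(0,∞)` -/

/-- Coercions of finite sums in `Lp` are a.e. the pointwise sums. [folklore] -/
theorem coeFn_finset_sum_ae {ι : Type*} (S : Finset ι) (g : ι → Lp ℂ 2 (volume : Measure ℝ)) :
    (⇑(∑ i ∈ S, g i) : ℝ → ℂ) =ᵐ[volume] fun u ↦ ∑ i ∈ S, (g i : ℝ → ℂ) u := by
  classical
  induction S using Finset.induction_on with
  | empty =>
      simp only [Finset.sum_empty]
      exact Lp.coeFn_zero ℂ 2 volume
  | insert a S ha ih =>
      simp only [Finset.sum_insert ha]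
      filter_upwards [Lp.coeFn_add (g a) (∑ i ∈ S, g i), ih] with u h1 h2
      rw [h1, Pi.add_apply, h2]

/-- **MAIN THEOREM (RH-free) — the Nyman–Beurling closure over an unbounded dilation menu.**
For every positive UNBOUNDED sequence `θ : ℕ → ℝ` and every `ε > 0` there are `J, N` and real
coefficients `c_{jk}` with
`‖𝟙_(0,1] - ∑_{j<J} ∑_{k<N} c_{jk} {θ_j/((k+1)x)}‖_{L²((0,∞))} < ε`.
No hypothesis on `ζ` is used beyond `ζ(1/2+it) ≠ 0` a.e. (countability of zeros): this is
Wiener's `L²` Tauberian theorem for the multiplicative group `(0,∞)` applied to `{1/x}`, whose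
Mellin transform `-ζ(s)/s` is a.e. non-zero on the critical line, restricted to the dense set of
dilations `Θ_θ = {θ_j/(k+1)}`.  Contrast: for the BOUNDED menus `{q^j/(k+1) : j < J}` the same
closure statement is EQUIVALENT to RH (`NbDilationB.nb_pow_dilations_iff`).
[cite: Katznelson2004, Ch. VI §3 Ex. 3.6 (Wiener); Burnol2004ForumMath16, §5; BaezDuarte2003,
Thm. 1.1] -/
theorem nb_unbounded_dilations (θ : ℕ → ℝ) (hθ : ∀ j, 0 < θ j)
    (hunb : ∀ T : ℝ, ∃ j, T < θ j) (ε : ℝ) (hε : 0 < ε) :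
    ∃ (J N : ℕ) (c : Fin J → Fin N → ℝ),
      eLpNorm (fun x : ℝ ↦ (Ioc (0 : ℝ) 1).indicator 1 x -
          ∑ j : Fin J, ∑ k : Fin N, c j k *
            Int.fract (θ (j : ℕ) / ((((k : ℕ) : ℝ) + 1) * x))) 2
        (volume.restrict (Ioi 0)) < ENNReal.ofReal ε := by
  classical
  -- the generators as elements of `L²(ℝ)`
  have tpos : ∀ p : ℕ × ℕ, 0 < θ p.1 / ((p.2 : ℝ) + 1) :=
    fun p ↦ div_pos (hθ p.1) (Nat.cast_add_one_pos p.2)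
  set G : ℕ × ℕ → ℝ → ℂ := fun p u ↦ Real.exp (-(1 / 2 : ℝ) * u) •
    (((Int.fract (θ p.1 / ((p.2 : ℝ) + 1) / Real.exp (-u)) : ℝ) : ℂ)) with hG_def
  have hG : ∀ p, MemLp (G p) 2 (volume : Measure ℝ) := fun p ↦ memLp_gen (tpos p)
  set v : ℕ × ℕ → Lp ℂ 2 (volume : Measure ℝ) := fun p ↦ (hG p).toLp (G p) with hv_def
  set K : Submodule ℂ (Lp ℂ 2 (volume : Measure ℝ)) := Submodule.span ℂ (Set.range v) with hK_def
  -- `Kᗮ = ⊥`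
  have hK : Kᗮ = ⊥ := by
    rw [Submodule.eq_bot_iff]
    intro φ hφ
    refine eq_zero_of_forall_inner_gen_eq_zero θ hθ hunb φ fun j k hm ↦ ?_
    have hmem : v (j, k) ∈ K := Submodule.subset_span ⟨(j, k), rfl⟩
    exact (Submodule.mem_orthogonal K φ).1 hφ _ hmem
  have htop : K.topologicalClosure = ⊤ := Submodule.topologicalClosure_eq_top_iff.2 hK
  -- the target `χ` in logarithmic coordinates
  set χc : ℝ → ℂ := fun x ↦ (((Ioc (0 : ℝ) 1).indicator (1 : ℝ → ℝ) x : ℝ) : ℂ) with hχc_def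
  have hχ_meas : Measurable χc :=
    measurable_ofReal.comp ((measurable_const (a := (1 : ℝ))).indicator measurableSet_Ioc)
  have hχ_mem : MemLp χc 2 (volume.restrict (Ioi 0)) := by
    have h : MemLp ((Ioc (0 : ℝ) 1).indicator (1 : ℝ → ℝ)) 2 (volume.restrict (Ioi (0 : ℝ))) :=
      memLp_indicator_const 2 measurableSet_Ioc 1 (Or.inr (by
        rw [Measure.restrict_apply measurableSet_Ioc]
        exact ((measure_mono inter_subset_left).trans_lt measure_Ioc_lt_top).ne))
    exact h.ofReal
  have hLχ : MemLp (fun u : ℝ ↦ Real.exp (-(1 / 2 : ℝ) * u) • χc (Real.exp (-u))) 2 volume :=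
    memLp_logPull hχ_meas hχ_mem
  set T : Lp ℂ 2 (volume : Measure ℝ) := hLχ.toLp _ with hT_def
  -- approximate `T` from `K`
  have hT : T ∈ (K.topologicalClosure : Set (Lp ℂ 2 (volume : Measure ℝ))) := by
    rw [htop]; trivial
  rw [Submodule.topologicalClosure_coe, Metric.mem_closure_iff] at hT
  obtain ⟨b, hbK, hb⟩ := hT ε hε
  obtain ⟨c, rfl⟩ := (Finsupp.mem_span_range_iff_exists_finsupp).1 hbK
  set S : Finset (ℕ × ℕ) := c.support with hS_def
  -- the difference as a function on `(0,∞)`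
  set D : ℝ → ℂ := fun x ↦ χc x - ∑ p ∈ S, c p *
    (((Int.fract (θ p.1 / ((p.2 : ℝ) + 1) / x)) : ℝ) : ℂ) with hD_def
  have hD_meas : Measurable D :=
    hχ_meas.sub (Finset.measurable_sum S fun p _ ↦ (measurable_fract_div _).const_mul _)
  have hD_mem : MemLp D 2 (volume.restrict (Ioi 0)) :=
    hχ_mem.sub (memLp_finsetSum S fun p _ ↦ (memLp_two_fract_div (tpos p)).const_mul (c p))
  have hLD : MemLp (fun u : ℝ ↦ Real.exp (-(1 / 2 : ℝ) * u) • D (Real.exp (-u))) 2 volume :=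
    memLp_logPull hD_meas hD_mem
  -- `T - b` is the class of the log-pull of `D`
  have hTb : T - c.sum (fun i a ↦ a • v i) = hLD.toLp _ := by
    apply Lp.ext
    have h1 := Lp.coeFn_sub T (c.sum fun i a ↦ a • v i)
    have h2 := coeFn_finset_sum_ae S (fun p ↦ c p • v p)
    have h3 : ∀ p ∈ S, (⇑(c p • v p) : ℝ → ℂ) =ᵐ[volume] fun u ↦ c p * G p u := by
      intro p _
      filter_upwards [Lp.coeFn_smul (c p) (v p), (hG p).coeFn_toLp] with u hu hu'
      rw [hu, Pi.smul_apply, smul_eq_mul]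
      exact congrArg _ hu'
    filter_upwards [h1, h2, (eventually_all_finset S).2 h3, hLχ.coeFn_toLp, hLD.coeFn_toLp]
      with u e1 e2 e3 e4 e5
    rw [e1, Pi.sub_apply, e5, e4]
    change _ - (⇑(∑ p ∈ S, c p • v p) : ℝ → ℂ) u = _
    rw [e2]
    rw [Finset.sum_congr rfl fun p hp ↦ e3 p hp, hD_def, hG_def]
    simp only [Complex.real_smul, mul_sub, Finset.mul_sum]
    congr 1
    exact Finset.sum_congr rfl fun p _ ↦ by ring
  -- hence `‖D‖_{L²((0,∞))} < ε`
  have hnorm : eLpNorm D 2 (volume.restrict (Ioi 0)) < ENNReal.ofReal ε := by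
    have h := hb
    rw [dist_eq_norm, hTb, Lp.norm_toLp, ← eLpNorm_Ioi_eq_eLpNorm_logPull D] at h
    exact (ENNReal.toReal_lt_toReal hD_mem.2.ne ENNReal.ofReal_ne_top).1
      (by rwa [ENNReal.toReal_ofReal hε.le])
  -- real parts of the coefficients, rectangular indexing
  set J : ℕ := S.sup Prod.fst + 1 with hJ_def
  set N : ℕ := S.sup Prod.snd + 1 with hN_def
  refine ⟨J, N, fun j k ↦ (c ((j : ℕ), (k : ℕ))).re, lt_of_le_of_lt (eLpNorm_mono fun x ↦ ?_) hnorm⟩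
  -- pointwise: the real combination is the real part of `D x`
  have hsub : S ⊆ Finset.range J ×ˢ Finset.range N := by
    intro p hp
    rw [Finset.mem_product, Finset.mem_range, Finset.mem_range]
    exact ⟨Nat.lt_succ_of_le (Finset.le_sup (f := Prod.fst) hp),
      Nat.lt_succ_of_le (Finset.le_sup (f := Prod.snd) hp)⟩
  have hsum : ∑ j : Fin J, ∑ k : Fin N, (c ((j : ℕ), (k : ℕ))).re *
      Int.fract (θ (j : ℕ) / ((((k : ℕ) : ℝ) + 1) * x)) =
        ∑ p ∈ S, (c p).re * Int.fract (θ p.1 / ((p.2 : ℝ) + 1) / x) := by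
    rw [Finset.sum_subset hsub (fun p _ hp ↦ by
      rw [Finsupp.notMem_support_iff.1 hp, Complex.zero_re, zero_mul]), Finset.sum_product]
    rw [Fin.sum_univ_eq_sum_range (fun j ↦ ∑ k : Fin N, (c (j, (k : ℕ))).re *
      Int.fract (θ j / ((((k : ℕ) : ℝ) + 1) * x))) J]
    refine Finset.sum_congr rfl fun j _ ↦ ?_
    rw [Fin.sum_univ_eq_sum_range (fun k ↦ (c (j, k)).re *
      Int.fract (θ j / (((k : ℝ) + 1) * x))) N]
    refine Finset.sum_congr rfl fun k _ ↦ ?_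
    rw [div_div]
  have hre : (Ioc (0 : ℝ) 1).indicator 1 x - ∑ j : Fin J, ∑ k : Fin N,
      (c ((j : ℕ), (k : ℕ))).re * Int.fract (θ (j : ℕ) / ((((k : ℕ) : ℝ) + 1) * x)) =
        (D x).re := by
    rw [hsum, hD_def]
    simp only [sub_re, ofReal_re, re_sum, re_mul_ofReal, hχc_def]
  rw [hre, Real.norm_eq_abs]
  exact Complex.abs_re_le_norm (D x)

/-- **COROLLARY — one expanding dilation already collapses the criterion.**  For every real
`q > 1` and every `ε > 0`: `‖𝟙_(0,1] - ∑_{j<J} ∑_{k<N} c_{jk} {q^j/((k+1)x)}‖_{L²((0,∞))} < ε`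
for suitable `J, N` and real `c_{jk}` — unconditionally.  For INTEGER `q` and `J` FIXED in
advance the same statement is equivalent to RH (`NbDilationB.nb_pow_dilations_iff`).
[cite: Katznelson2004, Ch. VI §3 Ex. 3.6; Burnol2004ForumMath16, §5] -/
theorem nb_dilations_pow {q : ℝ} (hq : 1 < q) (ε : ℝ) (hε : 0 < ε) :
    ∃ (J N : ℕ) (c : Fin J → Fin N → ℝ),
      eLpNorm (fun x : ℝ ↦ (Ioc (0 : ℝ) 1).indicator 1 x -
          ∑ j : Fin J, ∑ k : Fin N, c j k *
            Int.fract (q ^ (j : ℕ) / ((((k : ℕ) : ℝ) + 1) * x))) 2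
        (volume.restrict (Ioi 0)) < ENNReal.ofReal ε :=
  nb_unbounded_dilations (fun j ↦ q ^ j) (fun j ↦ pow_pos (by linarith) j)
    (fun T ↦ (pow_unbounded_of_one_lt T hq).imp fun _ h ↦ h) ε hε

end Summit.RiemannHypothesis.RiemannHypothesis.Theorems.Splittings.NbDilation
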